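import Summits.CriticalPhenomena.PercolationContinuityZ3.Theorems.PercNearOneGluingNoHeavyQuantGatedSliceMixLawPrime
import HarnessLib

/-!
# QUANT lane R8, T-DEC, leg (III), blob case — `LawDec.GatedSliceMixLaw'` DECOMPOSED: the residual CELLS after the typer's regimes C1–C4
# (`…QuantGatedSliceMixLawC1…C4`), typed as `Prop`s — the Q-ALONE cells (the moved two-point law is DEC by itself; arm-1 / arm-2 seam) and
# REGIME B (the shifted atom `h + a` of the weak-mid law is a giant; census-2 seam) — so that `GatedSliceMixLaw'` follows from them by the
# case analysis of `…QuantGatedSliceMixLawAssembly`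

builds on p205010 (kernel theorem, internal audit signed; external expert review pending)

Statement file (`--supports stmt-CriticalPhenomena-4575`), QUANT lane typer seat prim-quant-stmt (gen 30), rung R8 of
`run/shared/lean/prim/quant/LADDER.md`.  Memo `run/shared/lean/prim/quant/prim-quant-stmt-g30/MIXLAW-MIXTURES-G30.md` §6.  Definitions only
(`@[conjecture]` Props), no theorems.  Lead g32 ruling (INBOX 01:16Z): typer = regime A (h + a ≤ j; C1–C4 landed/landing), census-2 = regime B,
arm-1/arm-2 = the Q-alone side (θ = 0 cells).

THE CELLS.  Common frame (that of `GatedSliceMixLaw'` minus the weak-mid atom `h`, which the Q-alone cells do not see; `t := S + ag(1−z)`,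
`ℓ := k₁ + a`, `P := z·δ₀ + (1−z)·slice {k₁,k₂;λ} a g`, `U := usage y t j`): `0 < y < 1`, `0 ≤ z < 1`, `g ≤ 1`, `y ≤ (1−z)g`, `1 ≤ a`, `j < M + a`,
`0 < S`, `y·M ≤ S`, `S < j`, `S < M` (both from `S < h ≤ min(j,M)`), `k₁ ≤ k₂ ≤ M`, `0 ≤ λ ≤ 1`, `(1−z)(k₁ + (k₂−k₁)λ) = S`.  Q-ALONE CELLS
(conclusion `DECAtT y t j (M+a) P`; exact P-only census of the seat, explore/qcells.py, 120 000 instances, 0 failures in every cell):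
* `MixLawCellQ1`  — `k₂ + a ≤ j` (no giant; Theorem A; arm-1's (Q1)).
* `MixLawCellQ2`  — `k₁` is NOT a `t`-low: `¬(k₁ ≤ j ∧ 2k₁ < t)` (moment criterion; lead g30's `gateCell_decAtT_of_noLow`; arm-1's (Q2′)).
* `MixLawCellQ3`  — `ℓ` a `t`-low, `k₂` a mid compatible with `ℓ`, `k₂ + a` a giant, `k₂` NOT saturated by `ℓ`: `m₁'·U(ℓ,k₂) ≤ m₂` (7 000 / 0; memo §5).
* `MixLawCellQ4`  — `k₁` a `t`-low, the twin `ℓ ≤ j` not a `t`-low, `k₂ ≤ j` (36 000 / 0).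
* `MixLawCellQ4p` — `k₁` a `t`-low, the twin `ℓ ≤ j` above the target (`t < ℓ`), `k₂` a giant, twin NOT saturated: `m₁·U(k₁,ℓ) ≤ m₁'` (4 400 / 0).
* `MixLawCellQH`  — `2S < t` (covers every instance in which `h` is a `t`-low; 56 000 / 0).
* `MixLawCellQK`  — `k₂` a `t`-low (`k₂ ≤ j`, `2k₂ < t`; forces `k₂ < a`; 11 000 / 0).
* `MixLawCellQD`  — the degenerate corner `ℓ + k₂ ≤ t` (forces `k₁ = 0`, `g = 1`, `z = 0`, `λ = 1`, `P = δ_{k₂+a}`).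
REGIME B (conclusion = that of `GatedSliceMixLaw'`, the weak-mid law present and NON-DEC):
* `MixLawRegimeB` — the full frame of `GatedSliceMixLaw'` and: `k₁` a `t`-low, `ℓ ≤ j`, `k₂ + a ≥ j+1`, `t ≤ 2S` (so `h` is a mid), `h + a ≥ j + 1`
  (lead g32's kink analysis, memo FOR-PROVERS-MIXLAW-KINKS; census-2 g60).
ASSEMBLY (`…QuantGatedSliceMixLawAssembly`, typer): `MixLawCellQ1 → … → MixLawCellQD → MixLawRegimeB → GatedSliceMixLaw'`, the remaining branches
being the typer's kernel regimes C1 (`ℓ` low, `k₂` giant), C2 (`ℓ` low, `k₂` saturated mid), C3 (twin mid `≤ t`, `k₂` giant), C4 (twin `> t` saturated,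
`k₂` giant) and the easy cell `ℓ ≥ j+1` (criterion E).
HONEST STATUS: every cell OPEN as typed (evidence only); `GatedSliceMixLaw'`, CW, `GateMove`, `SingleGateConvClosed`, `TreeDEC`, `FarTreeRow` OPEN; RATE
class log* / honest sentence unchanged.

[this work]; the decomposition: lead g32 / arm-1 g41 / this seat.  The gluing rows served [cite: KozmaNitzan2024, Conjecture 3 (p. 15)]; product
measure [cite: Grimmett1999, §1.3 p. 10].
-/

noncomputable section

namespace Summit.CriticalPhenomena.PercolationContinuityZ3.Theorems

namespace Quant

open Finset

/-- the two-point law `{lo, hi; g}` (as in `…QuantLawDEC`) -/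
local notation3 "TP[" lo ", " hi ", " g ", " h "]" =>
  (g : ℝ) * (if (h : ℕ) = (hi : ℕ) then (1 : ℝ) else 0) + (1 - (g : ℝ)) * (if (h : ℕ) = (lo : ℕ) then (1 : ℝ) else 0)

namespace LawDec

/-! ### The Q-alone cells (the moved two-point law is DEC by itself) -/

/-- **CELL Q1** (`k₂ + a ≤ j`: the moved law has no giant; Theorem A at its own mean `t`).  Frame as in the file header.
Evidence: arm-1 g41 census ≈ 15 000 / 0; one step from `decAt_of_top_le`. [this work] [status: open] -/
@[conjecture] def MixLawCellQ1 : Prop :=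
  ∀ (y z g S lam : ℝ) (a j M k₁ k₂ : ℕ),
    0 < y → y < 1 → 0 ≤ z → z < 1 → g ≤ 1 → y ≤ (1 - z) * g → 1 ≤ a → j < M + a → 0 < S → y * (M : ℝ) ≤ S →
    S < (j : ℝ) → S < (M : ℝ) → k₁ ≤ k₂ → k₂ ≤ M → 0 ≤ lam → lam ≤ 1 → (1 - z) * ((k₁ : ℝ) + ((k₂ : ℝ) - k₁) * lam) = S →
    k₂ + a ≤ j →
    DECAtT y (S + (a : ℝ) * g * (1 - z)) j (M + a)
      (fun p => z * (if p = 0 then (1 : ℝ) else 0) + (1 - z) * slice (fun q => TP[k₁, k₂, lam, q]) a g p)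

/-- **CELL Q2** (`k₁` is not a `t`-low: `k₁ > j` or `2k₁ ≥ t`; then the zero is the only low of the moved law and the moment criterion
applies — lead g30's `gateCell_decAtT_of_noLow`).  Evidence: arm-1 g41 ≈ 62 000 / 0. [this work] [status: open] -/
@[conjecture] def MixLawCellQ2 : Prop :=
  ∀ (y z g S lam : ℝ) (a j M k₁ k₂ : ℕ),
    0 < y → y < 1 → 0 ≤ z → z < 1 → g ≤ 1 → y ≤ (1 - z) * g → 1 ≤ a → j < M + a → 0 < S → y * (M : ℝ) ≤ S →
    S < (j : ℝ) → S < (M : ℝ) → k₁ ≤ k₂ → k₂ ≤ M → 0 ≤ lam → lam ≤ 1 → (1 - z) * ((k₁ : ℝ) + ((k₂ : ℝ) - k₁) * lam) = S →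
    ¬ (k₁ ≤ j ∧ 2 * (k₁ : ℝ) < S + (a : ℝ) * g * (1 - z)) →
    DECAtT y (S + (a : ℝ) * g * (1 - z)) j (M + a)
      (fun p => z * (if p = 0 then (1 : ℝ) else 0) + (1 - z) * slice (fun q => TP[k₁, k₂, lam, q]) a g p)

/-- **CELL Q3** (the shifted low `ℓ = k₁ + a` a `t`-low, the top `k₂ ≤ j` a mid compatible with `ℓ`, `k₂ + a` a giant, and `k₂` can absorb
the WHOLE shifted low: `(1−z)(1−λ)g·usage(ℓ,k₂) ≤ (1−z)λ(1−g)`).  The complement of the saturation hypothesis of the typer's regime C2.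
Evidence: seat census 7 000 / 0 (the corner flow `ℓ→k₂`, `k₁→k₂`-leftover, `0→k₂`-leftover, rest→giant certifies all). [this work] [status: open] -/
@[conjecture] def MixLawCellQ3 : Prop :=
  ∀ (y z g S lam : ℝ) (a j M k₁ k₂ : ℕ),
    0 < y → y < 1 → 0 ≤ z → z < 1 → g ≤ 1 → y ≤ (1 - z) * g → 1 ≤ a → j < M + a → 0 < S → y * (M : ℝ) ≤ S →
    S < (j : ℝ) → S < (M : ℝ) → k₁ ≤ k₂ → k₂ ≤ M → 0 ≤ lam → lam ≤ 1 → (1 - z) * ((k₁ : ℝ) + ((k₂ : ℝ) - k₁) * lam) = S →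
    2 * ((k₁ + a : ℕ) : ℝ) < S + (a : ℝ) * g * (1 - z) → k₁ + a ≤ j →
    k₂ ≤ j → S + (a : ℝ) * g * (1 - z) ≤ 2 * (k₂ : ℝ) → S + (a : ℝ) * g * (1 - z) < ((k₁ + a : ℕ) : ℝ) + k₂ → j + 1 ≤ k₂ + a →
    (1 - z) * (1 - lam) * g * usage y (S + (a : ℝ) * g * (1 - z)) j (k₁ + a) k₂ ≤ (1 - z) * lam * (1 - g) →
    DECAtT y (S + (a : ℝ) * g * (1 - z)) j (M + a)
      (fun p => z * (if p = 0 then (1 : ℝ) else 0) + (1 - z) * slice (fun q => TP[k₁, k₂, lam, q]) a g p)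

/-- **CELL Q4** (`k₁` a `t`-low, its twin `ℓ = k₁ + a ≤ j` NOT a `t`-low, and the top `k₂ ≤ j` not a giant).  Evidence: seat census
36 000 / 0 (explore/qcells.py; classes LmM…, LMM…, Lmm… never host a deficient moved law). [this work] [status: open] -/
@[conjecture] def MixLawCellQ4 : Prop :=
  ∀ (y z g S lam : ℝ) (a j M k₁ k₂ : ℕ),
    0 < y → y < 1 → 0 ≤ z → z < 1 → g ≤ 1 → y ≤ (1 - z) * g → 1 ≤ a → j < M + a → 0 < S → y * (M : ℝ) ≤ S →
    S < (j : ℝ) → S < (M : ℝ) → k₁ ≤ k₂ → k₂ ≤ M → 0 ≤ lam → lam ≤ 1 → (1 - z) * ((k₁ : ℝ) + ((k₂ : ℝ) - k₁) * lam) = S →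
    k₁ ≤ j → 2 * (k₁ : ℝ) < S + (a : ℝ) * g * (1 - z) →
    k₁ + a ≤ j → S + (a : ℝ) * g * (1 - z) ≤ 2 * ((k₁ + a : ℕ) : ℝ) → k₂ ≤ j →
    DECAtT y (S + (a : ℝ) * g * (1 - z)) j (M + a)
      (fun p => z * (if p = 0 then (1 : ℝ) else 0) + (1 - z) * slice (fun q => TP[k₁, k₂, lam, q]) a g p)

/-- **CELL Q4′** (`k₁` a `t`-low, its twin `ℓ = k₁ + a ≤ j` ABOVE the target, `k₂` a giant, and the twin can absorb the WHOLE low: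
`(1−z)(1−λ)(1−g)·usage(k₁,ℓ) ≤ (1−z)(1−λ)g`).  The complement of the saturation hypothesis of the typer's regime C4.  Evidence: seat census
4 400 / 0. [this work] [status: open] -/
@[conjecture] def MixLawCellQ4p : Prop :=
  ∀ (y z g S lam : ℝ) (a j M k₁ k₂ : ℕ),
    0 < y → y < 1 → 0 ≤ z → z < 1 → g ≤ 1 → y ≤ (1 - z) * g → 1 ≤ a → j < M + a → 0 < S → y * (M : ℝ) ≤ S →
    S < (j : ℝ) → S < (M : ℝ) → k₁ ≤ k₂ → k₂ ≤ M → 0 ≤ lam → lam ≤ 1 → (1 - z) * ((k₁ : ℝ) + ((k₂ : ℝ) - k₁) * lam) = S →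
    k₁ ≤ j → 2 * (k₁ : ℝ) < S + (a : ℝ) * g * (1 - z) →
    k₁ + a ≤ j → S + (a : ℝ) * g * (1 - z) < ((k₁ + a : ℕ) : ℝ) → j + 1 ≤ k₂ →
    (1 - z) * (1 - lam) * (1 - g) * usage y (S + (a : ℝ) * g * (1 - z)) j k₁ (k₁ + a) ≤ (1 - z) * (1 - lam) * g →
    DECAtT y (S + (a : ℝ) * g * (1 - z)) j (M + a)
      (fun p => z * (if p = 0 then (1 : ℝ) else 0) + (1 - z) * slice (fun q => TP[k₁, k₂, lam, q]) a g p)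

/-- **CELL QH** (`2S < t`, i.e. `ag(1−z) > S`: the blob dominates the mean — this covers every instance of `GatedSliceMixLaw'` in which the
weak-mid atom `h` is itself a `t`-low, since `2h < t` and `h > S`).  Evidence: seat census 56 000 / 0. [this work] [status: open] -/
@[conjecture] def MixLawCellQH : Prop :=
  ∀ (y z g S lam : ℝ) (a j M k₁ k₂ : ℕ),
    0 < y → y < 1 → 0 ≤ z → z < 1 → g ≤ 1 → y ≤ (1 - z) * g → 1 ≤ a → j < M + a → 0 < S → y * (M : ℝ) ≤ S →
    S < (j : ℝ) → S < (M : ℝ) → k₁ ≤ k₂ → k₂ ≤ M → 0 ≤ lam → lam ≤ 1 → (1 - z) * ((k₁ : ℝ) + ((k₂ : ℝ) - k₁) * lam) = S →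
    2 * S < S + (a : ℝ) * g * (1 - z) →
    DECAtT y (S + (a : ℝ) * g * (1 - z)) j (M + a)
      (fun p => z * (if p = 0 then (1 : ℝ) else 0) + (1 - z) * slice (fun q => TP[k₁, k₂, lam, q]) a g p)

/-- **CELL QK** (the top `k₂` is itself a `t`-low: `k₂ ≤ j`, `2k₂ < t`; forces `k₂ < a`).  Evidence: seat census 11 000 / 0. [this work] [status: open] -/
@[conjecture] def MixLawCellQK : Prop :=
  ∀ (y z g S lam : ℝ) (a j M k₁ k₂ : ℕ),
    0 < y → y < 1 → 0 ≤ z → z < 1 → g ≤ 1 → y ≤ (1 - z) * g → 1 ≤ a → j < M + a → 0 < S → y * (M : ℝ) ≤ S →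
    S < (j : ℝ) → S < (M : ℝ) → k₁ ≤ k₂ → k₂ ≤ M → 0 ≤ lam → lam ≤ 1 → (1 - z) * ((k₁ : ℝ) + ((k₂ : ℝ) - k₁) * lam) = S →
    k₂ ≤ j → 2 * (k₂ : ℝ) < S + (a : ℝ) * g * (1 - z) →
    DECAtT y (S + (a : ℝ) * g * (1 - z)) j (M + a)
      (fun p => z * (if p = 0 then (1 : ℝ) else 0) + (1 - z) * slice (fun q => TP[k₁, k₂, lam, q]) a g p)

/-- **CELL QD** (the degenerate corner `ℓ + k₂ ≤ t`: since `k₂ ≥ S` and `ℓ ≥ a ≥ ag(1−z)`, this forces `k₁ = 0`, `g = 1`, `z = 0`, `S = k₂`,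
hence `λ = 1` and `P = δ_{k₂+a}`, trivially DEC).  Isolated so that the other cells may assume `t < ℓ + k₂`. [this work] [status: open] -/
@[conjecture] def MixLawCellQD : Prop :=
  ∀ (y z g S lam : ℝ) (a j M k₁ k₂ : ℕ),
    0 < y → y < 1 → 0 ≤ z → z < 1 → g ≤ 1 → y ≤ (1 - z) * g → 1 ≤ a → j < M + a → 0 < S → y * (M : ℝ) ≤ S →
    S < (j : ℝ) → S < (M : ℝ) → k₁ ≤ k₂ → k₂ ≤ M → 0 ≤ lam → lam ≤ 1 → (1 - z) * ((k₁ : ℝ) + ((k₂ : ℝ) - k₁) * lam) = S →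
    ((k₁ + a : ℕ) : ℝ) + k₂ ≤ S + (a : ℝ) * g * (1 - z) →
    DECAtT y (S + (a : ℝ) * g * (1 - z)) j (M + a)
      (fun p => z * (if p = 0 then (1 : ℝ) else 0) + (1 - z) * slice (fun q => TP[k₁, k₂, lam, q]) a g p)

/-! ### Regime B (the shifted atom of the weak-mid law is a giant) -/

/-- **REGIME B of `GatedSliceMixLaw'`** (census-2's seam, lead g32): the full frame of `GatedSliceMixLaw'` (weak-mid law present and NOT DEC)
and: `k₁` a `t`-low, `ℓ = k₁ + a ≤ j`, `k₂ + a ≥ j + 1`, `t ≤ 2S` (so `h > S ≥ t/2` is a mid), and `h + a ≥ j + 1` — `W_h` has ONE mid `h` and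
the giant `h + a`.  Conclusion: that of `GatedSliceMixLaw'`.  Evidence: the typer's census (classes LLmGmG, LLMGMG, LLGGMG, LLGGmG, LmGGMG, LMGGMG;
plans of memo MIXLAW-MIXTURES-G30 §6: 0 failures) and lead g32's kink analysis (1.5 M instances / 0). [this work] [status: open] -/
@[conjecture] def MixLawRegimeB : Prop :=
  ∀ (y z g S lam : ℝ) (a j M h k₁ k₂ : ℕ),
    0 < y → y < 1 → 0 ≤ z → z < 1 → g ≤ 1 → y ≤ (1 - z) * g → 1 ≤ a → j < M + a → 0 < S → y * (M : ℝ) ≤ S →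
    h ≤ j → h ≤ M → S < (h : ℝ) →
    ¬ DECAtT y (S + (a : ℝ) * g * (1 - z)) j (M + a) (weakMidLaw S g h a) →
    k₁ ≤ k₂ → k₂ ≤ M → 0 ≤ lam → lam ≤ 1 → (1 - z) * ((k₁ : ℝ) + ((k₂ : ℝ) - k₁) * lam) = S →
    k₁ ≤ j → 2 * (k₁ : ℝ) < S + (a : ℝ) * g * (1 - z) → k₁ + a ≤ j → j + 1 ≤ k₂ + a →
    S + (a : ℝ) * g * (1 - z) ≤ 2 * S → j + 1 ≤ h + a →
    ∃ θ : ℝ, 0 ≤ θ ∧ θ < 1 ∧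
      DECAtT y (S + (a : ℝ) * g * (1 - z)) j (M + a)
        (fun p => θ * weakMidLaw S g h a p
          + (1 - θ) * (z * (if p = 0 then (1 : ℝ) else 0) + (1 - z) * slice (fun q => TP[k₁, k₂, lam, q]) a g p))

/-! ### Correction (typer g30, 05:00Z): cell Q3 is FALSE as a Q-alone cell — the unsaturated mid needs the mixture -/

/-- **CELL A5 — the MIXTURE replacement of the refuted Q-alone cell `MixLawCellQ3`** (census-2 g61 / ARM-REF g83: `MixLawCellQ3` is FALSE,
witness `y = 15/26, z = 0, g = 3/5, S = 15/2, λ = 9/20, a = 1, j = M = 13, k₁ = 3, k₂ = 13` — the moved law is NOT DEC although its mid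
`k₂` can absorb the whole shifted low; the instance is a GENUINE mixture, `θ ∈ [0.005, 0.95]` for every admissible `h`).  Regime A cell with
the weak-mid law present: the full frame of `GatedSliceMixLaw'` (including `W_h ∉ D`, unused by the intended proof) and: the shifted low
`ℓ = k₁ + a` a `t`-low; `k₂ ≤ j` a mid compatible with `ℓ`; `k₂ + a ≥ j + 1`; `k₂` NOT saturated by `ℓ` (`(1−z)(1−λ)g·usage(ℓ,k₂) ≤ (1−z)λ(1−g)`);
`h + a ≤ j`, `2h ≥ t` (both atoms of `W_h` mids).  Conclusion: that of `GatedSliceMixLaw'`.  EVIDENCE (seat census explore/subB2.py, the thin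
sliver `2ℓ < t ≲ 2ℓ + 3/4` where P-deficient instances live): 400 P-deficient instances / 0 failures of the plan "k₂ ← all of ℓ; k₁ → W's mids;
zeros → giants + k₂'s leftover" (and of its variant with `k₁ → k₂`'s leftover first), joint θ-LP TRUE in all.  With this cell in place of
`MixLawCellQ3` the assembly `gatedSliceMixLaw'_of_cellsA` (`…QuantGatedSliceMixLawAssemblyA`) holds. [this work] [status: open] -/
@[conjecture] def MixLawCellA5 : Prop :=
  ∀ (y z g S lam : ℝ) (a j M h k₁ k₂ : ℕ),
    0 < y → y < 1 → 0 ≤ z → z < 1 → g ≤ 1 → y ≤ (1 - z) * g → 1 ≤ a → j < M + a → 0 < S → y * (M : ℝ) ≤ S →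
    h ≤ j → h ≤ M → S < (h : ℝ) →
    ¬ DECAtT y (S + (a : ℝ) * g * (1 - z)) j (M + a) (weakMidLaw S g h a) →
    k₁ ≤ k₂ → k₂ ≤ M → 0 ≤ lam → lam ≤ 1 → (1 - z) * ((k₁ : ℝ) + ((k₂ : ℝ) - k₁) * lam) = S →
    2 * ((k₁ + a : ℕ) : ℝ) < S + (a : ℝ) * g * (1 - z) → k₁ + a ≤ j →
    k₂ ≤ j → S + (a : ℝ) * g * (1 - z) ≤ 2 * (k₂ : ℝ) → S + (a : ℝ) * g * (1 - z) < ((k₁ + a : ℕ) : ℝ) + k₂ → j + 1 ≤ k₂ + a →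
    (1 - z) * (1 - lam) * g * usage y (S + (a : ℝ) * g * (1 - z)) j (k₁ + a) k₂ ≤ (1 - z) * lam * (1 - g) →
    h + a ≤ j → S + (a : ℝ) * g * (1 - z) ≤ 2 * (h : ℝ) →
    ∃ θ : ℝ, 0 ≤ θ ∧ θ < 1 ∧
      DECAtT y (S + (a : ℝ) * g * (1 - z)) j (M + a)
        (fun p => θ * weakMidLaw S g h a p
          + (1 - θ) * (z * (if p = 0 then (1 : ℝ) else 0) + (1 - z) * slice (fun q => TP[k₁, k₂, lam, q]) a g p))

end LawDec

end Quant

end Summit.CriticalPhenomena.PercolationContinuityZ3.Theorems
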